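import Summits.QuantumFields.YangMills.Theorems.BalabanUVNodesN12BillH12ForStub1VWK1AxV11OfJunctionRowsRunGuarded
import Summits.QuantumFields.YangMills.Theorems.BalabanUVNodesN12AtTheta13OfThm1CCMWSmallWindow
import Literature.MathematicalPhysics.QuantumFieldTheory.Balaban1983to89.Node00.Record13NumericsOfThm1CCMWZBChi

/-!
# BalabanUVNodes ∕ N24 ⟵ N12 → K1ᴬ — v11.4 (R-a″) RUN-KEYED EDITION: N12's MEMORY-GUARDED BILL `h12F` OF THE LINE-2′ ENGINE READ AT THE ENGINE's WITNESS FAMILY through dag-n12-d's RUN-GUARDED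
# JUNCTION G4ʳ ✓p837975 `N12BillH12ForStub1VWK1AxV11OfJunctionRowsRunGuarded.h12_bill_at_liveRepin₁₃Ax_of_junctionRowsRunGuarded` (G4 ✓p835673's rows verbatim, conclusion keyed to the RUN `N₀(θ,P,P.K) ≤ P.K`), with the re-pin identity, the
# ν₀-pin, K0b's residuals of record, the Θ-level numerics and NODE O's (2.7)-smallness rows PAID AT THE PIN, and the β-SIGN LEAF DISPLAYED (dag-n12-d g39 «h12F PAYER NOTE» 2026-08-31T21:20:37Z;
# ★★★ director-ym №682∕№685: v11.3's step-keyed guard HOLLOW — ref-P g18 ∕ ref-Q g17 KERNEL NOTE 3, ◆ J31; ✦ v11.4 33e8cfceee350f1c; this seat's LOCATED-G4-EXPORT ∕ n12-d's G4ʳ, pub-ymgap INBOX 23:33–23:41Z)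

Cell `pub-ymgap` (HUMAN RULING D-0062), seat `pub-ymgap-dag-n24-c` g27 (R134 N24 [B2 composite] s2 «knit at the record»; -a hand on K1ᴬ `stmt-QuantumFields-27239` LINE 2′, skeleton
v11.2 2c0c0eed585a0c47); `--kind proof --supports stmt-QuantumFields-27239 --as helper`, count-neutral.  The N12 analogue of this lineage's N09 door-with-rows-paid files (X) ✓p816166 ∕
✓p831186: a child's bill, displayed by the engine as ONE opaque binder, re-read AT THE WITNESS as the child's own junction rows, every row that the witness's letters decide PAID.  Step (e′) of ★★★ №682∕№685:
the CONCLUSION here is the RUN-KEYED MEMORY-GUARDED h12 body — G4ʳ's — = the `h12F` of the v11.4 engine edition `…N24K1AxV114Line2VWN09T7AxAtCofinalBetaSocketGaussPinPrintedZBY`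
((W) ✓p816238's `h12F` body + the per-run antecedent `N0OfRecord₁₃Ax θN P P.K ≤ P.K →`, the registered currency :545–:547); the v11.3 sibling ✓p836716 (step-keyed) is history.

THE WITNESS.  The engine binds `h12F` for every member `θN := theta13OfThm1CCMWZBAx F 2 j γ a₀ ε₀ ε₂₉ B₃ B₃′ a₀ a₁ Efl logz` of the LINE-2′ family (read through `gaussPinH (ofHistoryBlind
⟨θN, Zr⟩) χ⋆`, whose `.toStage13Params` IS `θN`, `rfl`) under the prefix `γ ≤ ½`, `0 ≤ B₃, B₃′`, `0 < a₀, a₁`, the boxes `BetaLowerH bl γ β(θN)` ∕ `BetaUpperH β′ γ β(θN)`, `β′γ² ≤ ¾`,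
the re-centred provisos; its guarded body is G4ʳ's conclusion at `Θ := θN`.  G4ʳ concludes at `Θ.liveRepin₁₃Ax F 2`; AT THE MEMBER `θN.liveRepin₁₃Ax F 2 = θN` holds by `rfl` (node00-def-Y's
`Record13LiveSelectorChi` ∕ `Record13NumericsOfThm1CCMWZBChi`: the family is built on the live re-pin; kernel-checked here), so G4ʳ READ AT `θN` has exactly the engine's (run-keyed guarded) body.

WHAT IS PAID AT THE PIN (G4ʳ's rows = G4's that the member's `rfl` faces `ν = numerics7OfThm1CCM F.L j ε₀ B₃ B₃′ a₀ a₁`, `ν.r = ν.p₀ = ν.M₂ = 1`, `ν.M₁ = τ9.M = L^j`, `ν.εreg = a₀`,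
`ν.A₀ = A₀ᶜᶜ¹(L; B₃, B₃′, a₀, a₁)` and the prefix letters decide): the ν₀-pin `{ν₀ with εreg := Θ.ν.εreg} = Θ.ν` (`ν₀ := θN.ν`, `rfl`; the five `ν₀`-rows now read `θN.ν`) ·
`Θ.HasResidualsOfRecord` (def-Y `hasResidualsOfRecord_theta13OfThm1CCMWZBAx`, hypothesis-free) · `1 ≤ ν.r` · `0 ≤ ν.A₀` (`A0OfThm1CC1_nonneg`) · `0 < ν.M₂` · `0 < τ9.M` · `2 ≤ ν.M₁` (from
the head's floor row `(d+14)·L ≤ M₁` at the run `⟨0,0,0⟩`) · `0 < ν.εreg` · `ν.εreg ≤ a₁₅` and `ν.εreg < a₁₅` (ONE letter row `a₀ < a₁₅`: the bill's [15] radius sits strictly above the member's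
regularity threshold) · NODE O's (2.7)-smallness `SmallnessFor γβ β′ ½ 2 1` and `γβ·A₀(log γβ⁻²) ≤ 1∕10` (this cell's dag-n21-c∕n12 lemmas `smallnessFor_half_two_one`,
`gamma_mul_p0Profile_le_tenth` at `β₀ := ½`, `Lς := 2`, from the NEW letter rows `0 < γβ ≤ γ`, `γβ ≤ e⁻³` and the prefix: `0 ≤ bβ ≤ β ≤ β′` at the point `γβ` of the box gives `0 ≤ β′`,
`γβ²β′ ≤ γ²β′ ≤ ¾`, `A₀ᶜᶜ¹ ≤ A₀ᶜ ≤ 1∕16`) · the upper box `BetaUpperH β′ γβ β(θN)` (the prefix's box shrunk to `]0, γβ]`, `FlowStep.box_mono`).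

WHAT STAYS DISPLAYED (= WHICH ROWS BLOCK `h12F` AT THE WITNESS, BY NAME): ★ THE β-SIGN LEAF `0 ≤ bβ`, `BetaLowerH bβ γβ β(θN)` — LOCATED: the engine calls `h12F` at the cofinal socket's member,
whose lower letter is `bl := −β′` (the SIGN-FREE |β|-box of `K0AxMomentRoad.CofinalBetaSocketAxBody`); N12's junction of record needs `0 ≤ bβ` (the coupling step of the `N₀`-equation,
dag-n12-d `N12CouplingStepOfBetaSign(Chi)`: one step of [I] (0.20) with `β ≥ 0` = the located unprinted input T09.F, [I] p.264 ∕ [II-LF] p.355), so the prefix's lower box CANNOT feed it and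
the sign leaf is a SECOND consumer of NODE O's AF sign next to the run rows (iv) — K0ᴬ's socket does not deliver it · the window letters `γβ` (`0 < γβ ≤ γ`, `γβ ≤ e⁻³`; N12 chooses
`γ₁₂ := γβ`) · EVERY OTHER ROW OF G4ʳ VERBATIM at `Θ := θN` (instance geometry, (R) name `h15` + THE ONE-LENGTH STEP TOKEN `hstep` at the bill's [15] constants `B₁₅ a₁₅ a₁₅′` (N07, no
producer), `Adm`'s rows, NODE 00's live mass, the term-pin data + 12P §1's window-guarded per-run rows, `Λ ≠ ∅`, the ℍ-leaves + (1.80), the (J0′) head's instance ∕ cap ∕ budget ∕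
tolerance rows under `∃ ρJ εW δ₀` ∕ `∃ C ρ …` ∕ `∃ R` ∕ `∀ eR` ∕ `∀ δ`; the nine coupling-dependent per-run rows asked on window runs WHOSE MEMORY FITS).  CONCLUSION = the RUN-KEYED GUARDED `h12F` body at `θN`.

LOCATED-g39-2 «SHORT RUNS» (dag-n12-d, INBOX 21:24:55Z ∕ 21:28:16Z; dag-lead WORDS 933; ✦ plan I.14462) IS REPAIRED UPSTREAM: F4's per-run row `tNk` — refutable from its neighbours
at every K = 1 window run, which made F4 (and an F4-based edition of this file, INTENT-1 ON HOLD I.14467) VACUOUS as a conditional — is in G4∕G4ʳ the PER-RUN MEMORY GUARD: an antecedent of the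
nine coupling-dependent rows (step-keyed there — the payer holds `hk`, so step = run) and of the conclusion's per-run clause (RUN-keyed in G4ʳ) (print's scope: no 𝐑 at runs shorter than the memory `N₀`, [IV] p.177 (ii) ∕ p.179; ME #57 of record).  CONSUMER FACT for
(R-a′) (this lineage's pen; ✦ I.14462 «independent confirmation»): the pin conjunct of the rung-1ⱽᵂ text has NO kernel consumer downstream — rung 2ⱽᵂ `K1AxV11Defs.RunRowsAtSomeRecord13PWSVW`
keeps only `∀ P, smallCouplings → Nodes (leavesP w P)`, the END road reads `Nodes` on window runs — and (Q) ✓p813442 §2 already witnesses N12's node OUTSIDE the pin's scope by a free carrier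
(`hW0 : ¬ λW.kSel P < P.K → B15Leaf (W₀ P)`), so the guard moves the `hW ∕ hW0` split from `λW.kSel P < P.K` to `λW.kSel P < P.K ∧ N₀ ≤ λW.kSel P + 1` in the editions that follow the
re-registration.

HONEST FRAMING.  Kernel bookkeeping BY NAME (one application of G4ʳ + eleven `rfl`∕numeric payments); nothing of Bałaban asserted; `h12F` is NOT paid (its payer still owes every displayed
row, per member); `stub_nodes13PWSVW` NOT closed; N12 NOT discharged; K0ᴬ ∕ K1ᴬ ∕ K3ᴬ OPEN (K1ᴬ 0∕6); counts unmoved (discharged 8∕27 · K 1∕4); one finite 𝕋⁴ programme at fixed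
`ε = L^{-K}` — NOT continuum ∕ ℝ⁴ ∕ OS; NOT the Yang–Mills mass gap (Clay).  THEOREMS ONLY (0 `def`, 0 `instance`, 0 `sorry`, standard axioms); generator `gen_h12.py` over the TREE copy
of G4ʳ (every edit asserted by count).
Sources (bookkeeping only): [Balaban1989LargeFieldI] (0.2)–(0.6) p.176, Prop. 1 (1.78) p.194, (1.80) p.195, (1.89) p.198, p.200, (1.99)–(1.102) pp.200–201; [Balaban1985Variational] Thm 1 (8)
p.279, Prop. 2 p.281; [Balaban1988Convergent] (2.4)–(2.9) pp.255–256, (3.22)–(3.25) pp.269–270; [Balaban1987RG1] (0.17)–(0.20) pp.255–256, Thm 1 p.259, §1 p.264, (2.9) p.266.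
-/

noncomputable section

open scoped BigOperators ENNReal
open MeasureTheory
open scoped Matrix.Norms.L2Operator
open MeasureTheory Set Finset Metric Filter
open scoped Matrix.Norms.L2Operator BigOperators Matrix RealInnerProductSpace Real InnerProductSpace Topology

namespace Summit.QuantumFields.YangMills.BalabanUVNodes.N24N12BillH12AtWitnessOfJunctionRowsRunGuardedAx

open Summit.QuantumFields.YangMills.BalabanUVNodes.N12BillH12ForStub1VWK1AxV11OfJunctionRowsRunGuarded (h12_bill_at_liveRepin₁₃Ax_of_junctionRowsRunGuarded)
open Summit.QuantumFields.YangMills.BalabanUVNodes.N12AtTheta13OfThm1CCMWSmallWindow (smallnessFor_half_two_one gamma_mul_p0Profile_le_tenth)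
open Literature.MathematicalPhysics.QuantumFieldTheory.Balaban1983to89.B15DeterminingSetsB
open Literature.MathematicalPhysics.QuantumFieldTheory.Balaban1983to89
open Literature.MathematicalPhysics.QuantumFieldTheory.Balaban1983to89.T4Continuum (T4Family LStep Letter walk walkEnd netDisp holAt)
open Literature.MathematicalPhysics.QuantumFieldTheory.Balaban1983to89.DagBinding
open Literature.MathematicalPhysics.QuantumFieldTheory.Balaban1983to89.Node00
open FlowStep (prefixOf BetaLowerH BetaUpperH)
open B15Claim189Assembly (new189 chiPP dom half)
open B15 (Prop1Printed Ineq180)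
open B15.BasicStep (Claim189)
open B8Eq17ClassAkV1 (plaqsOf)
open B14.Eq216Concrete (inputs feeds)
open GaugeGroup (dist1)
open GaugeField (plaqHol gaugeAct)
open B15RPrime1100OfRep (rPrimeDataOfSel)
open T4CubeChartGnomonic (SU2)
open B15Prop1ChartSU2 (su2Chart)
open B15Prop1SliceCoordinates (GaugeSlice ιA)
open T4AxialGaugeSmallField (castSite boxPlaqs boxBonds)
open B6BondElimination (unitVec)
open B6TreeGaugePoincare (curl)
open B16Eq18Proof (box)
open B15Extension193 (extend)
open B15ShellGauge193 (shellGauge)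
open B15Sect1Instances (fun177stdB)
open B14.Eq213DetSet (Bj maxDomT)
open B14.Eq213MaximalDomains (side)
open B14.Eq22Determines (blockIter IsBlockUnion)
open Literature.MathematicalPhysics.QuantumFieldTheory.BalabanImbrieJaffe1984to88.BIJ85Eq453GaugeField (qsstarGIter0)
open B16Sect1Backgrounds (expMul toMS)
open B15DeterminingSets (pts DetBackground genSet IsMinimizer MSField avgFamily bondsOf DetSet embIter AgreeOn)
open B5Eq118OneStroke (iterBlockOf)
open Literature.MathematicalPhysics.QuantumFieldTheory.Balaban1983to89.Node00 (coeField constrEnumB)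
open B15Eq112TorusCover (lift)
open ExpMeanLog (deltaSU)
open B15Prop1Carrier (lfVarOn InstOn InstOn.std InstOn.stdB plaqsInside)
open Summit.QuantumFields.YangMills.BalabanUVNodes.N12AtRecord13Prop1KnitThm1WindowDirectDatumScaleLettersDischargedAtLengthOfRegNameAndStepOfRecord (thm1LetterT_atLength_pTop_of_variationalThm1RegSepCoP7MGB_lamTop)
open B15Claim189Assembly (Setting189)
open B14DomainGeom (Pt)
open B15.PrelimIntegrations (Ineq191 Ineq195)
open B15Chi124DetSets (E124)
open B15Claim189PrintedConditions (omegaOfChain)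
open B15Claim189PinsOfHistory (N0OfRecord₁₃)
open B15Claim189LambdaPin (enlD)
open Summit.QuantumFields.YangMills.BalabanUVNodes.N12MinimiserFamilyKnitRowThm1LettersAtLengthOnZOfRecordBR (exists_R_hMinRow_of_thm1LettersAtLength_alongOrbit_onZ_ofRecord)
open Summit.QuantumFields.YangMills.BalabanUVNodes.N12Thm1LettersAtLengthOfK0GridGB (thm1LetterT_atLength_of_variationalThm1RegSepCoP7MGB)
open B15Prop1NumericsThresholds (plaqSmallOn_of_le)
open B15Prop1MinimiserClassAtDatumScaleAtLengthB (isMinimizerB_withEps_base_of_thm1AtLength isMinimizerB_withEps_of_norm_lt_atLength lamBondsSeq_congr)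
open Summit.QuantumFields.YangMills.BalabanUVNodes.N12DirectChartPackageOfClassRowL1FamilyB (exists_hWD_chartHalf_of_class_uniform_rowl1_family)
open Summit.QuantumFields.YangMills.BalabanUVNodes.N12Prop1DirectOfClassOnlyRowL1UniformBLam (exists_rowPreimageProxiesLetter_family_uniformB_lamBondsSeq)
open Summit.QuantumFields.YangMills.BalabanUVNodes.N12Prop1DirectOfClassOnlyB (exists_curvatureLetters_family)
open Summit.QuantumFields.YangMills.BalabanUVNodes.N12MinimiserFamilyKnitRowThm1Letters (boxRow3_of_boxRow5)
open T4AdjointCovarianceUnitary (lieSU)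
open B15Prop1GradientFromNearValueAtCoPRecord (far_letter_of_box)
open B15Prop1AnalyticExtClause (cplxVec anExt)
open B15Prop1ChartCalculusSU2 (E3)
open B15Sect1Instances (lamDatumP)
open B11Thm1ExistsUniqueTokensGB (VariationalThm1EUSepCoP7MGB VariationalThm1EUStepCoP7MGB)
open B11Thm1ExistsUniqueInductionG (truncSeq)
open Summit.QuantumFields.YangMills.BalabanUVNodes.N12EUStepTokensAtRealisedDataLam (variationalThm1EUSepCoP7MGB_realised_of_step_of_reg_lamTop)
open Summit.QuantumFields.YangMills.BalabanUVNodes.N12Thm1LettersAtLengthOfK0GridGB (blockSat_torusClassSeq)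
open Summit.QuantumFields.YangMills.BalabanUVNodes.N12Thm1LettersAtLengthOfK0GridGB (thm1LetterEU_atLength_of_variationalThm1EUSepCoP7MGB)
open B15Claim189PinsOfHistory (N0OfRecord₁₃Chi N0OfRecord₁₃Ax)
open B14FlowStep (SmallnessFor)

section
variable {F : T4Family}

/-- **★★★ N12's BILL `h12F` OF THE LINE-2′ ENGINE READ AT THE WITNESS MEMBER `θN = theta13OfThm1CCMWZBAx F 2 j γ a₀ ε₀ ε₂₉ B₃ B₃′ a₀ a₁ Efl logz` THROUGH G4ʳ's RUN-GUARDED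
JUNCTION** (dag-n12-d ✓p837975; rows = G4 ✓p835673's, conclusion run-keyed), the re-pin identity `θN.liveRepin₁₃Ax = θN` (`rfl`), the ν₀-pin (`ν₀ := θN.ν`), K0b's residuals of record, `1 ≤ r`, `0 ≤ A₀`, `0 < M₂`, `0 < M`,
`2 ≤ M₁`, `0 < εreg`, `εreg ≤∕< a₁₅` and NODE O's (2.7)-smallness rows `tS ∕ t10` + the shrunk upper box PAID from the member's faces and the engine's prefix letters
`hγh hB hB' ha₀ ha₁ hbox' hβ'`; DISPLAYED: the β-SIGN leaf `0 ≤ bβ`, `BetaLowerH bβ γβ β(θN)` (T09.F — not the socket's `−β′` box), the window letters `0 < γβ ≤ γ`, `γβ ≤ e⁻³`,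
the letter row `a₀ < a₁₅`, and every other row of G4 verbatim at `Θ := θN` (per-run rows step-keyed, conclusion RUN-keyed).  CONCLUSION = the v11.4 engine's `h12F` body at `θN` ((W) ✓p816238's +
the antecedent `N0OfRecord₁₃Ax θN P P.K ≤ P.K →`; pin `hθ` consumed `_ rfl`).  Nothing of Bałaban asserted;
`h12F` NOT paid; N12 NOT discharged.
[cite: Balaban1989LargeFieldI, (0.2)–(0.6) p.176, Prop. 1 (1.78) p.194, (1.80) p.195, (1.89) p.198, (1.99)–(1.102) pp.200–201; Balaban1985Variational, Thm 1 (8) p.279, Prop. 2 p.281; Balaban1988Convergent, (2.4)–(2.8) pp.255–256, (3.22)–(3.25) pp.269–270; Balaban1987RG1, (0.20) p.256, Thm 1 p.259, §1 p.264, (2.9) p.266] -/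
theorem N24_h12F_at_theta13OfThm1CCMWZBAx_of_junctionRowsRunGuarded
    -- THE MEMBER OF THE LINE-2′ WITNESS FAMILY under its ABSTRACT NAME `θN` (the engine's `h12F` prefix letters this file reads; the pin `hθ` is consumed `_ rfl` by the payer)
    {j : ℕ} {γ ε₀ ε₂₉ B₃ B₃' a₀ a₁ : ℝ} {Efl logz : B12.RunParams → ℕ → ℝ}
    (θN : Stage13Params F 2) (hθ : θN = theta13OfThm1CCMWZBAx F 2 j γ a₀ ε₀ ε₂₉ B₃ B₃' a₀ a₁ Efl logz)
    (hγh : γ ≤ 1 / 2) (hB : 0 ≤ B₃) (hB' : 0 ≤ B₃') (ha₀ : 0 < a₀) (ha₁ : 0 < a₁)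
    {β' : ℝ} (hbox' : BetaUpperH β' γ (betaOfRecord₁₃Ax F 2 θN)) (hβ' : β' * γ ^ 2 ≤ 3 / 4)
    -- F4's INSTANCE ∕ GUARD ∕ STEP-TOKEN ROWS, VERBATIM (the bill's [15] constants renamed `B₁₅ a₁₅ a₁₅′`; `ν₀ := θN.ν`)
    (hd3 : ∀ P : B12.RunParams, 3 ≤ (F.P P.K).d)
    (h0 : ∀ P : B12.RunParams, 0 < (F.P P.K).d)
    (ι : B12.RunParams → Type)
    {B₁₅ a₁₅ a₁₅' : ℝ}
    (Z Λ : ∀ P : B12.RunParams, ι P → Set (Site (F.P P.K) 0))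
    (k : ∀ P : B12.RunParams, ι P → ℕ)
    (M : ∀ P : B12.RunParams, ι P → ℝ)
    (hk0 : ∀ (P : B12.RunParams) (i : ι P), 0 < k P i)
    (hk1 : ∀ (P : B12.RunParams) (i : ι P), k P i + 1 ≤ (F.P P.K).m + (F.P P.K).K)
    (T : ∀ (P : B12.RunParams) (i : ι P), Finset (PBond (F.P P.K) (k P i)))
    (lo hi : ∀ P : B12.RunParams, ι P → Fin (F.P P.K).d → ℤ)
    (n : ∀ P : B12.RunParams, ι P → ℕ)
    (hn : ∀ (P : B12.RunParams) (i : ι P) κ, hi P i κ ≤ lo P i κ + n P i)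
    (hN : ∀ (P : B12.RunParams) (i : ι P), n P i + 2 < (F.P P.K).sitesPerDir (k P i))
    (hbox : ∀ (P : B12.RunParams) (i : ι P), pts (k P i) (Λ P i) = (castSite '' Set.Icc (lo P i) (hi P i) : Set (Site (F.P P.K) (k P i))))
    (hZ : ∀ (P : B12.RunParams) (i : ι P), (boxPlaqs (lo P i - 1) (hi P i + 1) : Set (Plaq (F.P P.K) (k P i))) ⊆ plaqsInside (pts (k P i) (Z P i)))
    (hTG0 : ∀ (P : B12.RunParams) (i : ι P), T P i = (box (fun κ => (hi P i κ - lo P i κ + 1).toNat) (lo P i)).image fun x =>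
      (⟨castSite (x - unitVec ⟨0, h0 P⟩), ⟨0, h0 P⟩⟩ : PBond (F.P P.K) (k P i)))
    (hN5 : ∀ (P : B12.RunParams) (i : ι P) κ, ((hi P i κ - lo P i κ + 1).toNat : ℤ) + 5 < (F.P P.K).sitesPerDir (k P i))
    (Kb : ∀ P : B12.RunParams, ι P → ℕ)
    (hK1 : ∀ (P : B12.RunParams) (i : ι P), 1 ≤ Kb P i)
    (hKn : ∀ (P : B12.RunParams) (i : ι P) κ, (hi P i κ - lo P i κ + 1).toNat ≤ Kb P i)
    (ext : ∀ (P : B12.RunParams) (i : ι P), GaugeField (F.P P.K) (k P i) SU2 → GaugeField (F.P P.K) (k P i) SU2)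
    (hext : ∀ (P : B12.RunParams) (i : ι P) Vk, ext P i Vk = extend (pts (k P i) (Λ P i)) (shellGauge Vk (lo P i) (hi P i)) Vk)
    (hlohi : ∀ (P : B12.RunParams) (i : ι P), lo P i ≤ hi P i)
    (LO HI : ∀ P : B12.RunParams, ι P → Fin (F.P P.K).d → ℤ)
    (hLO : ∀ (P : B12.RunParams) (i : ι P), LO P i ≤ lo P i - 1)
    (hHI : ∀ (P : B12.RunParams) (i : ι P), hi P i + 1 ≤ HI P i)
    (n' : ∀ P : B12.RunParams, ι P → ℕ)
    (hn' : ∀ (P : B12.RunParams) (i : ι P) κ, HI P i κ ≤ LO P i κ + n' P i)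
    (hn'N : ∀ (P : B12.RunParams) (i : ι P), n' P i < (F.P P.K).sitesPerDir (k P i))
    (hR' : ∀ (P : B12.RunParams) (i : ι P), (boxPlaqs (LO P i) (HI P i) : Set (Plaq (F.P P.K) (k P i))) ⊆ plaqsInside (pts (k P i) (Z P i)))
    {γ₈ bx : B12.RunParams → ℝ}
    (hγ : ∀ P : B12.RunParams, 0 < γ₈ P)
    (hbx : ∀ P : B12.RunParams, 0 ≤ bx P)
    (hbxM : ∀ (P : B12.RunParams) (i : ι P), 12 * ((F.P P.K).d : ℝ) * ((n P i : ℝ) + 2) ^ 2 ≤ bx P * (M P i) ^ 2)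
    (hM : ∀ (P : B12.RunParams) (i : ι P), 1 ≤ (M P i))
    (W : ∀ P : B12.RunParams, ι P → Finset (Plaq (F.P P.K) 0))
    (hWbox : ∀ (P : B12.RunParams) (i : ι P), ∀ q : Plaq (F.P P.K) 0, q.src ∈ ((box (fun κ => (F.P P.K).L ^ (k P i) * ((hi P i κ - lo P i κ + 1).toNat + 3 + 1) - 1) (fun κ => ((F.P P.K).L : ℤ) ^ (k P i) * (lo P i κ - 2))).image
        (fun z => (castSite z : Site (F.P P.K) 0))) → q ∈ W P i)
    (c : ∀ P : B12.RunParams, ι P → ℕ)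
    (hkc : ∀ (P : B12.RunParams) (i : ι P), k P i + c P i ≤ (F.P P.K).m + (F.P P.K).K)
    (hc : ∀ (P : B12.RunParams) (i : ι P), 4 * (F.P P.K).d + (3 * ((F.P P.K).d * (((F.P P.K).L - 1) / 2)) + 5) + 3 < 2 * (F.P P.K).L ^ c P i)
    (X : ∀ P : B12.RunParams, ι P → Set (Site (F.P P.K) 0))
    (D₀ : ∀ P : B12.RunParams, ι P → ℕ)
    (hBox : ∀ (P : B12.RunParams) (i : ι P), ∀ x ∈ X P i, ∀ w : List (Letter (F.P P.K).d),
      w.length ≤ (∑ i' ∈ Finset.range (k P i + 1), ((F.P P.K).d * (((F.P P.K).L ^ i' - 1) / 2) + 1)) + (3 * ((F.P P.K).d * (((F.P P.K).L - 1) / 2)) + 5) * (F.P P.K).L ^ k P i + (F.P P.K).L ^ k P i →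
      ∀ μ : Fin (F.P P.K).d, (⟨B14.Eq22Determines.blockIter (k P i) (walkEnd x w), μ⟩ : PBond (F.P P.K) (k P i)) ∈ (boxBonds (LO P i) (HI P i) : Set (PBond (F.P P.K) (k P i))))
    (hWX : ∀ (P : B12.RunParams) (i : ι P), ∀ p ∈ W P i, p.src ∈ X P i ∧ p.src.shift p.μ ∈ X P i ∧ p.src.shift p.ν ∈ X P i ∧ (p.src.shift p.μ).shift p.ν ∈ X P i ∧ (p.src.shift p.ν).shift p.μ ∈ X P i)
    (hfeedsX : ∀ (P : B12.RunParams) (i : ι P) (ν' : Fin (F.P P.K).d), ∀ z ∈ box (fun κ => (hi P i κ - lo P i κ + 1).toNat + 3) (fun κ => lo P i κ - 2), ∀ b₀ : PBond (F.P P.K) 0,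
      (b₀ ∈ feeds (k P i) (⟨(castSite z : Site (F.P P.K) (k P i)), ⟨0, h0 P⟩⟩ : PBond (F.P P.K) (k P i)) ∨
        b₀ ∈ feeds (k P i) (⟨((castSite z : Site (F.P P.K) (k P i))).shift ⟨0, h0 P⟩, ν'⟩ : PBond (F.P P.K) (k P i)) ∨
        b₀ ∈ feeds (k P i) (⟨((castSite z : Site (F.P P.K) (k P i))).shift ν', ⟨0, h0 P⟩⟩ : PBond (F.P P.K) (k P i)) ∨
        b₀ ∈ feeds (k P i) (⟨(castSite z : Site (F.P P.K) (k P i)), ν'⟩ : PBond (F.P P.K) (k P i))) → b₀.src ∈ X P i ∧ b₀.tgt ∈ X P i)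
    {cE cA : B12.RunParams → ℝ}
    (hcE0 : ∀ P : B12.RunParams, 0 ≤ cE P)
    (hcE : ∀ (P : B12.RunParams) (i : ι P), 12 * ((F.P P.K).d : ℝ) * ((n P i : ℝ) + 2) ^ 2 ≤ cE P)
    (hγle : ∀ (P : B12.RunParams) (i : ι P), γ₈ P / (M P i) ^ 5 ≤ 1 / 2 / (2 * (3 * (Kb P i : ℝ) ^ 2 + 2 * (Kb P i : ℝ) ^ 4)))
    (hZblk : ∀ (P : B12.RunParams) (i : ι P), IsBlockUnion (k P i) (Z P i))
    (hB₃ : 0 < B₁₅)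
    -- [15] THEOREM 1 (8) = (R), GUARD-GENERIC NAMED FACT in K0⁷'s house AT PRINT's CURRENCY `(lamDatum F, dataSmall7LamTopOf F 2)` (`Adm : StepGuard F`; at `Adm := A‴(c,c₀,c₁)` and the
    -- stub's constants = K0⁷'s V23 stub 1ᴮ `K0V23Defs.Prop8StepCoPGridGBAt` through k0-s1-w1's 53′; INHABITED there by `K0Stub1BHolds` ∕ this seat's 112 — at GENERIC constants: displayed)
    (Adm : Node00.StepGuard F) (h15 : VariationalThm1RegSepCoP7MGB F 2 Adm (lamDatum F) (dataSmall7LamTopOf F 2) B₁₅ a₁₅ a₁₅')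
    -- THE GUARD's TWO STRUCTURAL ROWS print's induction (11)–(14) reads: the standing range and stability under truncation (`truncSeq`); at `A‴` both are arithmetic (dag-n12-c ✓p782972)
    (hAdmK : ∀ ν M' g K k' (s : SeqOfRecord F ν M' g K k'), Adm ν M' g K k' s → k' ≤ (F.P K).m + (F.P K).K)
    (hAdmTr : ∀ ν M' g K k' (s : SeqOfRecord F ν M' g K (k' + 1)), 0 < k' → Adm ν M' g K (k' + 1) s → Adm ν M' g K k' (truncSeq s))
    -- THE (J0′) HEAD's SKELETON ROWS AT εreg-BLIND NUMERICS `θN.ν` (the head of record ✓p740879 is instantiated at `θN.ν`; `θN.ν` is pinned to `θN.ν` off the class threshold below)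
    (hdiv₀ : ∀ (P : B12.RunParams) (i : ι P), side (F.P P.K).L θN.ν.M₁ (k P i) ∣ (F.P P.K).sitesPerDir 0)
    (hfloor₀ : ∀ P : B12.RunParams, ((F.P P.K).d + 14) * (F.P P.K).L ≤ θN.ν.M₁)
    (hMrad₀ : ∀ P : B12.RunParams, (4 * (F.P P.K).d + (3 * ((F.P P.K).d * (((F.P P.K).L - 1) / 2)) + 5)) * (F.P P.K).L ^ 2 + 2 * (F.P P.K).d * (F.P P.K).L + 12 ≤ θN.ν.M₁)
    (hM₁₀ : ∀ P : B12.RunParams, (((F.P P.K).d + 4) * (F.P P.K).L + 6) * (F.P P.K).L ^ 2 ≤ θN.ν.M₁)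
    -- THE GUARD ROW at the head's εreg-blind numerics `θN.ν`, per instance, along the degenerate history `(M, g) := (θN.ν.M₁, 1)` (β's `hadm`; at `A‴`: `c ≤ θN.ν.M₁`, `k P i + c₀ ≤ m + K`, `L^{c₁} ∣ θN.ν.M₁`)
    (hadm₀ : ∀ (P : B12.RunParams) (i : ι P) (s₁ : SeqOfRecord F θN.ν θN.ν.M₁ (fun _ => (1 : ℝ)) P.K (k P i)), Adm θN.ν θN.ν.M₁ (fun _ => (1 : ℝ)) P.K (k P i) s₁)
    -- the BOX SCOPE row of the head (every `k`-bond inside `Z^{(k)}` is a bond of the region box)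
    (hscope : ∀ (P : B12.RunParams) (i : ι P), {e : PBond (F.P P.K) (k P i) | e.src ∈ pts (k P i) (Z P i) ∧ e.tgt ∈ pts (k P i) (Z P i)} ⊆ boxBonds (LO P i) (HI P i))
    -- the analytic family's bound scale (`𝓐₀ P i := 4·𝓐₁`)
    (𝓐₁ : ℝ) (h𝓐₁ : 1 < 𝓐₁)
    -- IN PLACE OF [15] THEOREM 1 (E∕U)'s NAME: THE ONE-LENGTH STEP TOKEN ᴮ at the SAME guard and the SAME constants, print's currency `(lamDatum F, dataSmall7LamTopOf F 2)`, for any ONE `C₁` with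
    -- `2L³ ≤ C₁`, `8L³ < C₁B₃` ([15] Prop. 2 + Sects. B–E at ONE length given `U₀` with (14); «INHABITED BY»: OPEN — N07's obligation; the (E∕U)ᴮ name AT REGULAR-REALISED DATA follows from it
    -- and `h15` by dag-n12-c g38's `variationalThm1EUSepCoP7MGB_realised_of_step_of_reg_lamTop` ✓p782780 — SUPPLY-at-1 ∕ LIFT proved there)
    {C₁ : ℝ} (hC₁ : 2 * (F.L : ℝ) ^ 3 ≤ C₁) (hCB : 8 * (F.L : ℝ) ^ 3 < C₁ * B₁₅)
    (hstep : VariationalThm1EUStepCoP7MGB F 2 Adm (lamDatum F) (dataSmall7LamTopOf F 2) C₁ B₁₅ a₁₅ a₁₅') :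
    -- THE THREE THRESHOLDS of the (J0′) head, announced from (θN.ν, P.K, Z P i, k P i, the two [15] names) BEFORE λ ∕ the class threshold ∕ the data budget (U4-existential, instance-dependent)
    ∃ ρJ εW δ₀ : ∀ P : B12.RunParams, ι P → ℝ, (∀ P i, 0 < ρJ P i) ∧ (∀ P i, 0 < εW P i) ∧ (∀ P i, 0 < δ₀ P i) ∧
    -- THE NINE LETTER CONSTANTS of the chart half (`C ρ Kτ ρτ ρ5`), the (P4)′ row (`εH B₁`), the small-below ∕ curvature letters (`ρ6 M₂`) — functions of `(P.K, k P)`, from the uniform producers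
    ∃ C ρ Kτ ρτ ρ5 εH B₁ ρ6 M₂ : ∀ P : B12.RunParams, ι P → ℝ, (∀ P i, 0 ≤ C P i) ∧ (∀ P i, 0 < ρ P i) ∧ (∀ P i, 0 ≤ Kτ P i) ∧ (∀ P i, 0 < ρτ P i) ∧ (∀ P i, 0 < ρ5 P i) ∧
      (∀ P i, 0 < εH P i) ∧ (∀ P i, 0 ≤ B₁ P i) ∧ (∀ P i, 0 < ρ6 P i) ∧ (∀ P i, 0 ≤ M₂ P i) ∧
    ∀ (lam : ResidW F 2), (∀ P : B12.RunParams, lam.kSel P = P.K - 1) →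
      -- THE β-SIGN LEAF (T09.F; `0 ≤ bβ ≤ β` on `]0, γβ]` — NOT supplied by the engine's sign-free socket `hβc`, whose lower letter is `−β′`) at a window level `γβ ≤ min γ e⁻³` (= the bill's `γ₁₂`)
      ∀ (bβ γβ : ℝ), (0 ≤ bβ) → (0 < γβ) → (γβ ≤ γ) → (γβ ≤ Real.exp (-3)) → (BetaLowerH bβ γβ (betaOfRecord₁₃Ax F 2 θN)) →
      (∀ P : B12.RunParams, lam.kSel P < P.K → Step.InInterval γβ P.K (gOfRecord₁₃Ax F 2 θN P) → N0OfRecord₁₃Ax θN P (lam.kSel P + 1) ≤ lam.kSel P + 1 → ∀ s, LiveSeq F 2 θN.ν θN.τ9 P (gOfRecord₁₃Ax F 2 θN P) (lam.kSel P + 1)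
        (slotsTOfRecord F 2 θN.ν θN.τ9 (EOfRecord₁₃Ax F 2 θN) (wOfRecord₉ F 2 θN.toStage9Params)
          θN.ppSel P (gOfRecord₁₃Ax F 2 θN P) (lam.kSel P + 1)) s →
      0 < ∫ V, rterm (reprTOfRecord₁₃Chi F 2 θN (chiβOfRecord₁₃Ax F 2 θN) P (lam.kSel P)) s V ∂(fieldMeasure (F.P P.K) (lam.kSel P + 1) (SU 2))) →
      -- THE TERM PINS (167ᴾ ∕ 12P ✓p516715 §1) in place of the free rows at `λ.D1100 ∕ λ.D189`: data `σ sq Nm p₁ Dst`, then 12P §1's rows run by run below the torus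
      ∀ (σ : ∀ P : B12.RunParams, Sit189 F 2 P.K),
      ∀ (sq : ∀ P : B12.RunParams, SeqOfRecord F θN.ν θN.τ9.M (gOfRecord₁₃Ax F 2 θN P) P.K (lam.kSel P + 1)),
      ∀ (Nm : B12.RunParams → ℕ),
      ∀ (p₁ : ℕ),
      ∀ (Dst : ∀ P : B12.RunParams, Setting189 (F.P P.K) (SU 2) (MSField (F.P P.K) (SU 2) × ((j : ℕ) → VecField (F.P P.K) j (EuclideanSpace ℝ (Fin (2 ^ 2 - 1))))) (Pt (F.P P.K).d)),
      (∀ P : B12.RunParams, Dst P = ((ResidW.pinRPrime₁₃Ax lam θN).pinD189ΛH θN.ν θN.A₁ θN.τ9.M (gOfRecord₁₃Ax F 2 θN) (fun P => (((((σ P).pinZres θN.ν θN.τ9.M (gOfRecord₁₃Ax F 2 θN P) (sq P) (N0OfRecord₁₃Ax θN P (lam.kSel P + 1))).pinSides θN.ν (gOfRecord₁₃Ax F 2 θN P) (lam.kSel P + 1 - Nm P) (lam.kSel P + 1)).pinXΩ4 (sq P) (enlD F θN.ν θN.τ9.M P (gOfRecord₁₃Ax F 2 θN P))).pinOmegaPP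 (sq P) (Nm P) (enlD F θN.ν θN.τ9.M P (gOfRecord₁₃Ax F 2 θN P)))) sq Nm p₁).D189 P) →
      (∀ P : B12.RunParams, lam.kSel P < P.K → Step.InInterval γβ P.K (gOfRecord₁₃Ax F 2 θN P) → N0OfRecord₁₃Ax θN P (lam.kSel P + 1) ≤ lam.kSel P + 1 → N0OfRecord₁₃Ax θN P (lam.kSel P + 1) ≤ Nm P) →
      (∀ P : B12.RunParams, lam.kSel P < P.K → 0 ≤ (σ P).β) →
      (∀ P : B12.RunParams, lam.kSel P < P.K → (σ P).β ≤ 1 / 4) →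
      (∀ P : B12.RunParams, lam.kSel P < P.K → 2 ≤ (σ P).L₀) →
      (∀ P : B12.RunParams, lam.kSel P < P.K → (σ P).L₀ ^ 2 ≤ ((F.P P.K).L : ℝ)) →
      (∀ P : B12.RunParams, lam.kSel P < P.K → 0 ≤ (σ P).O1 * (σ P).B₃ * (σ P).B₅) →
      (∀ P : B12.RunParams, lam.kSel P < P.K → 0 ≤ (σ P).δ) →
      (∀ P : B12.RunParams, lam.kSel P < P.K → Step.InInterval γβ P.K (gOfRecord₁₃Ax F 2 θN P) → N0OfRecord₁₃Ax θN P (lam.kSel P + 1) ≤ lam.kSel P + 1 → (2 + (121 / 120) ^ 2 * ((σ P).O1 * (σ P).B₃ * (σ P).B₅ * (θN.τ9.M : ℝ) ^ 5)) *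
      ((((σ P).L₀ ^ 2) ^ (N0OfRecord₁₃Ax θN P (lam.kSel P + 1) - 1))⁻¹) ≤ 1 / 4) →
      (∀ P : B12.RunParams, lam.kSel P < P.K → (121 / 120) ^ 2 * ((σ P).O1 * (σ P).B₃ * (σ P).B₅ * (θN.τ9.M : ℝ) ^ 5) * Real.exp (-(4 * (σ P).δ * (θN.τ9.M : ℝ))) ≤ 1 / 12) →
      (∀ P : B12.RunParams, lam.kSel P < P.K → Step.InInterval γβ P.K (gOfRecord₁₃Ax F 2 θN P) → N0OfRecord₁₃Ax θN P (lam.kSel P + 1) ≤ lam.kSel P + 1 → (((enlD F θN.ν θN.τ9.M P (gOfRecord₁₃Ax F 2 θN P)) 4 (lam.kSel P + 1 + 1 - (N0OfRecord₁₃Ax θN P (lam.kSel P + 1)))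
        (omegaOfChain (sq P) (lam.kSel P + 1 + 1 - (N0OfRecord₁₃Ax θN P (lam.kSel P + 1)))))ᶜ ∩ (σ P).Z).Nonempty) →
      (∀ P : B12.RunParams, lam.kSel P < P.K → Step.InInterval γβ P.K (gOfRecord₁₃Ax F 2 θN P) → N0OfRecord₁₃Ax θN P (lam.kSel P + 1) ≤ lam.kSel P + 1 → ∀ U, new189 (Dst P) U → ∀ p ∈ plaqsOf (half (Dst P)),
      Ineq191 (dist1 (plaqHol ((Dst P).Upp U) p)) ((Dst P).devV'' U p) (Dst P).α (((Dst P).L ^ (Dst P).h)⁻¹) ((Dst P).ε (Dst P).h) (E124 (Dst P).ε (Dst P).L (Dst P).η (Dst P).k (Dst P).h)) →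
      (∀ P : B12.RunParams, lam.kSel P < P.K → Step.InInterval γβ P.K (gOfRecord₁₃Ax F 2 θN P) → N0OfRecord₁₃Ax θN P (lam.kSel P + 1) ≤ lam.kSel P + 1 → ∀ U, new189 (Dst P) U → ∀ p ∈ plaqsOf (half (Dst P)),
      Ineq195 ((Dst P).devV'' U p) (dist1 (plaqHol ((Dst P).Uhalf U ((Dst P).boxOf p)) p)) (Dst P).α (((Dst P).L ^ (Dst P).h)⁻¹) ((Dst P).ε (Dst P).h) (E124 (Dst P).ε (Dst P).L (Dst P).η (Dst P).k (Dst P).h)) →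
      (∀ P : B12.RunParams, lam.kSel P < P.K → Step.InInterval γβ P.K (gOfRecord₁₃Ax F 2 θN P) → N0OfRecord₁₃Ax θN P (lam.kSel P + 1) ≤ lam.kSel P + 1 → ∀ U, new189 (Dst P) U → ∀ j, (Dst P).h ≤ j → j ≤ (Dst P).k → ∀ p ∈ plaqsOf (dom (Dst P) j),
      Ineq191 (dist1 (plaqHol ((Dst P).Upp U) p)) ((Dst P).dev97 U p) (Dst P).α (((Dst P).L ^ j)⁻¹) ((Dst P).ε j) (E124 (Dst P).ε (Dst P).L (Dst P).η (Dst P).k j)) →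
      (∀ P : B12.RunParams, lam.kSel P < P.K → Step.InInterval γβ P.K (gOfRecord₁₃Ax F 2 θN P) → N0OfRecord₁₃Ax θN P (lam.kSel P + 1) ≤ lam.kSel P + 1 → ∀ U, new189 (Dst P) U → ∀ j, (Dst P).h ≤ j → j ≤ (Dst P).k → ∀ p ∈ plaqsOf (dom (Dst P) j),
      Ineq191 ((Dst P).dev97 U p) ((Dst P).dev0 U p) (Dst P).α (((Dst P).L ^ j)⁻¹) ((Dst P).ε j) (E124 (Dst P).ε (Dst P).L (Dst P).η (Dst P).k j)) →
      (∀ P : B12.RunParams, lam.kSel P < P.K → Step.InInterval γβ P.K (gOfRecord₁₃Ax F 2 θN P) → N0OfRecord₁₃Ax θN P (lam.kSel P + 1) ≤ lam.kSel P + 1 → ∀ U, new189 (Dst P) U → ∀ j, (Dst P).h ≤ j → j ≤ (Dst P).k → ∀ p ∈ plaqsOf (dom (Dst P) j),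
      Ineq180 ((Dst P).dev0 U p) ((Dst P).ε (Dst P).k) (Dst P).η (Dst P).B₃ (Dst P).B₅ (Dst P).M (Dst P).δ ((Dst P).dist p) (Dst P).O1) →
      (∀ (P : B12.RunParams) (i : ι P), ∀ (ν' : Fin (F.P P.K).d), ∀ z ∈ box (fun κ => (hi P i κ - lo P i κ + 1).toNat + 3) (fun κ => lo P i κ - 2),
      (castSite z : Site (F.P P.K) (k P i)) ∈ pts (k P i) (maxDomT θN.ν.M₁ (Z P i) (k P i)) ∧
        (castSite z : Site (F.P P.K) (k P i)).shift ⟨0, h0 P⟩ ∈ pts (k P i) (maxDomT θN.ν.M₁ (Z P i) (k P i)) ∧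
        (castSite z : Site (F.P P.K) (k P i)).shift ν' ∈ pts (k P i) (maxDomT θN.ν.M₁ (Z P i) (k P i))) →
      (∀ P : B12.RunParams, (143 * (((((F.P P.K).d + 4 : ℕ) : ℝ)) ^ 2 / 4) ^ 2) * (θN.ν.εreg * (F.P P.K).L ^ 2) ≤ 1 / 3) →
      (∀ P : B12.RunParams, 2 * (θN.ν.εreg * (F.P P.K).L ^ 2) ≤ 2 * deltaSU (Fin 2) / ((((F.P P.K).d + 4) * (F.P P.K).L : ℕ) : ℝ) ^ 2) →
      (∀ P : B12.RunParams, (((((F.P P.K).d + 2) * (F.P P.K).L : ℕ) : ℝ) ^ 2 / 4) * (2 * (θN.ν.εreg * (F.P P.K).L ^ 2)) < deltaSU (Fin 2)) →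
      (∀ (P : B12.RunParams) (i : ι P), ∀ x ∈ X P i, ∃ x₀ ∈ maxDomT θN.ν.M₁ (Z P i) (k P i), ∃ w₀ : List (Letter (F.P P.K).d), w₀.length ≤ D₀ P i ∧ walkEnd x₀ w₀ = x) →
      (∀ (P : B12.RunParams) (i : ι P), D₀ P i + 3 * (∑ i' ∈ Finset.range (k P i + 1), ((F.P P.K).d * (((F.P P.K).L ^ i' - 1) / 2) + 1)) + ((3 * ((F.P P.K).d * (((F.P P.K).L - 1) / 2)) + 5) + 5) * (F.P P.K).L ^ k P i +
      (((F.P P.K).d + 4) * (F.P P.K).L + 2) * (∑ l ∈ Finset.Ico 0 (k P i), (F.P P.K).L ^ l) + 4 ≤ (F.P P.K).L ^ (k P i - 1) * θN.ν.M₁) →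
      (∀ P : B12.RunParams, 4 * (F.P P.K).L ≤ θN.ν.M₁) →
      (∀ (P : B12.RunParams) (i : ι P) (y : Site (F.P P.K) 0), B14.Eq22Determines.blockIter (k P i) y ∈ (castSite '' Set.Icc (lo P i - 1) (hi P i + 1) : Set (Site (F.P P.K) (k P i))) → y ∈ maxDomT θN.ν.M₁ (Z P i) 1) →
      (∀ (P : B12.RunParams) (i : ι P), side (F.P P.K).L θN.ν.M₁ (k P i) ∣ (F.P P.K).sitesPerDir 0) →
      (∀ (P : B12.RunParams) (i : ι P), 1 / 2 * (B₁₅ * (cE P + 1) * (F.P P.K).eta 1 ^ 2) ^ 2 * (Nat.card {q : Plaq (F.P P.K) 0 // q ∈ plaqsOf (maxDomT θN.ν.M₁ (Z P i) 1)} : ℝ) ≤ cA P) →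
      -- the bill's [15] radius `a₁₅` sits STRICTLY above the member's regularity threshold `θN.ν.εreg = a₀` (the bill's two rows `εreg ≤ a₀`, `εreg < a₀`, here ONE letter inequality)
      (a₀ < a₁₅) →
      -- THE GUARD CAP `eG` and the cap-level datum tolerance `ρnG` with the head's rows at the cap (all upper bounds on `eG`, `ρnG`, `θN.ν.εreg`)
      ∀ (eG ρnG : ∀ P : B12.RunParams, ι P → ℝ), (∀ (P : B12.RunParams) (i : ι P), 0 < eG P i) →
      (∀ (P : B12.RunParams) (i : ι P), 6 * ((((F.P P.K).d - 1 : ℕ)) : ℝ) * (F.P P.K).L ^ (k P i) * (2 * ((cE P + 1) * eG P i)) ≤ ρJ P i) →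
      (∀ (P : B12.RunParams) (i : ι P), 12 * ((((F.P P.K).d - 1 : ℕ)) : ℝ) * (F.P P.K).L * θN.ν.εreg ≤ ρJ P i) →
      (∀ (P : B12.RunParams) (i : ι P), θN.ν.εreg ≤ εW P i) →
      (∀ P : B12.RunParams, (143 * (((((F.P P.K).d + 4 : ℕ) : ℝ)) ^ 2 / 4) ^ 2) * (2 * ((F.P P.K).L : ℝ) ^ 2 * θN.ν.εreg) ≤ 1 / 3) →
      (∀ P : B12.RunParams, 2 * (2 * ((F.P P.K).L : ℝ) ^ 2 * θN.ν.εreg) ≤ 2 * deltaSU (Fin 2) / ((((F.P P.K).d + 4) * (F.P P.K).L : ℕ) : ℝ) ^ 2) →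
      (∀ (P : B12.RunParams) (i : ι P), (cE P + 1) * (2 * eG P i) ≤ a₁₅' ∧ B₁₅ * ((cE P + 1) * (2 * eG P i)) ≤ θN.ν.εreg) →
      (∀ (P : B12.RunParams) (i : ι P), 0 ≤ ρnG P i) →
      (∀ (P : B12.RunParams) (i : ι P), max (ρnG P i) ((((2 * (∑ i' ∈ Finset.range (k P i + 1), ((F.P P.K).d * (((F.P P.K).L ^ i' - 1) / 2) + 1)) + 1 +
                  (3 * ((F.P P.K).d * (((F.P P.K).L - 1) / 2)) + 5) * (F.P P.K).L ^ (k P i) : ℕ) : ℝ)) ^ 2 / 4 * (θN.ν.εreg * (F.P P.K).eta 0 ^ 2) +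
                ((3 * ((F.P P.K).d * (((F.P P.K).L - 1) / 2)) + 5 : ℕ) : ℝ) * (6 * ((((((F.P P.K).d + 2) * (F.P P.K).L : ℕ) : ℝ) ^ 2 / 4) * (2 * (θN.ν.εreg * (F.P P.K).L ^ 2))) * ∑ i' ∈ Finset.range (k P i), ((F.P P.K).L : ℝ) ^ i') + ((3 * ((F.P P.K).d * (((F.P P.K).L - 1) / 2)) + 5 : ℕ) : ℝ) * ρnG P i) ≤ δ₀ P i) →
      (∀ (P : B12.RunParams) (i : ι P), (((F.P P.K).d : ℝ) * n' P i + 1) * ((((F.P P.K).d - 1 : ℕ) : ℝ) * n' P i * ((12 * (F.P P.K).d * (n P i + 2) ^ 2 + 1) * eG P i) + 3 * (F.P P.K).d * (n P i + 2) ^ 2 * eG P i) ≤ ρnG P i) →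
      -- THE (J0′) RADIUS, announced BEFORE the data budget `eR`
      ∃ R : ∀ P : B12.RunParams, ι P → ℝ, (∀ P i, 0 < R P i) ∧
      ∀ (eR : ∀ P : B12.RunParams, ι P → ℝ), (∀ (P : B12.RunParams) (i : ι P), 0 < eR P i) → (∀ (P : B12.RunParams) (i : ι P), eR P i ≤ eG P i) →
      ∀ (ρn : ∀ P : B12.RunParams, ι P → ℝ),
      (∀ (P : B12.RunParams) (i : ι P), (((F.P P.K).d : ℝ) * n' P i + 1) * ((((F.P P.K).d - 1 : ℕ) : ℝ) * n' P i * ((12 * (F.P P.K).d * (n P i + 2) ^ 2 + 1) * eR P i)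
      + 3 * (F.P P.K).d * (n P i + 2) ^ 2 * eR P i) ≤ ρn P i) →
      ∀ (cJ : B12.RunParams → ℝ), (∀ P : B12.RunParams, 0 ≤ cJ P) →
      (∀ (P : B12.RunParams) (i : ι P), (cE P + 1) * (2 * eR P i) ≤ a₁₅' ∧ B₁₅ * ((cE P + 1) * (2 * eR P i)) ≤ θN.ν.εreg) →
      (∀ (P : B12.RunParams) (i : ι P), 6 * ((((F.P P.K).d - 1 : ℕ)) : ℝ) * (F.P P.K).L * (2 * B₁₅ * (cE P + 1) * eR P i) ≤ ρ5 P i) →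
      (∀ (P : B12.RunParams) (i : ι P), 6 * ((((F.P P.K).d - 1 : ℕ)) : ℝ) * (F.P P.K).L * (2 * B₁₅ * (cE P + 1) * eR P i) ≤ ρ6 P i) →
      (∀ (P : B12.RunParams) (i : ι P), 2 * cA P * eR P i / R P i + 2 * ((Nat.card {q : Plaq (F.P P.K) 0 // q ∈ plaqsOf (maxDomT θN.ν.M₁ (Z P i) 1)} : ℝ) * (1 + 8 * (4 * 𝓐₁) ^ 4)) / (R P i * eR P i) ≤ cJ P) →

    ∀ δ : ∀ P : B12.RunParams, ι P → ℝ, (∀ P i, 0 < δ P i) →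
      -- the endpoint's EXPLICIT THRESHOLD per run (every quantity a displayed binder or a count of the run's instance — no `∃ δ₀`), then its TOLERANCE rows at `δ P i`
      (∀ (P : B12.RunParams) (i : ι P), δ P i ≤ min (min (min (ρ P i) (ρτ P i) / 2)
        (min 1 (1 / 2 / (2 * (3 * (Kb P i : ℝ) ^ 2 + 2 * (Kb P i : ℝ) ^ 4)) /
          (max ((32 * (((F.P P.K).d : ℝ) - 1) + 8 * (((F.P P.K).d : ℝ) - 1) + (2 * (((F.P P.K).d : ℝ) - 1) * B₁ P i * (((∑ j ∈ Finset.range (k P i + 1), (2 * (F.P P.K).d) ^ j : ℕ) : ℝ) * M₂ P i))) * (12 * (4 * 𝓐₁) / R P i * Real.sqrt (Nat.card {b : PBond (F.P P.K) 0 // b ∈ {b : PBond (F.P P.K) 0 | b.src ∈ maxDomT θN.ν.M₁ (Z P i) 1 ∨ b.tgt ∈ maxDomT θN.ν.M₁ (Z P i) 1}})) ^ 2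
            + (8 * (((F.P P.K).d : ℝ) + 1) * (2 * (Kτ P i + 1)) + 8 * ((F.P P.K).d : ℝ) * (((box (fun κ => (hi P i κ - lo P i κ + 1).toNat + 3) (fun κ => lo P i κ - 2)).image (fun z => (castSite z : Site (F.P P.K) (k P i)))).card : ℝ) * (C P i * (12 * (4 * 𝓐₁) / R P i * Real.sqrt (Nat.card {b : PBond (F.P P.K) 0 // b ∈ {b : PBond (F.P P.K) 0 | b.src ∈ maxDomT θN.ν.M₁ (Z P i) 1 ∨ b.tgt ∈ maxDomT θN.ν.M₁ (Z P i) 1}}))) ^ 2)) 0 + 1)))) (εH P i)) →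
      ∀ (hfloor : ∀ (P : B12.RunParams) (i : ι P), ((((4 * (F.P P.K).d + (3 * ((F.P P.K).d * (((F.P P.K).L - 1) / 2)) + 5) + 3 : ℕ) : ℝ)) ^ 2 * ((F.P P.K).L : ℝ) ^ 2 / 4 + ((3 * ((F.P P.K).d * (((F.P P.K).L - 1) / 2)) + 5 : ℕ) : ℝ) * (24 * (((((F.P P.K).d + 2) * (F.P P.K).L : ℕ) : ℝ) ^ 2 / 4))) * (2 * B₁₅ * (cE P + 1) * eR P i) + ((3 * ((F.P P.K).d * (((F.P P.K).L - 1) / 2)) + 5 : ℕ) : ℝ) * ρn P i ≤ δ P i),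
      ∃ (lamW : ResidW F 2) (γ₁₂ : ℝ), 0 < γ₁₂ ∧ (∀ P : B12.RunParams, 1 ≤ P.K → lamW.kSel P < P.K) ∧
        ∀ P : B12.RunParams, lamW.kSel P < P.K → Step.InInterval γ₁₂ P.K (gOfRecord₁₃Ax F 2 θN P) →
          N0OfRecord₁₃Ax θN P P.K ≤ P.K →
          B15Leaf (WOfRecord₁₃Ax F 2 θN lamW P) := by
  subst hθ
  -- F4 at its own leading rows, the (J0′) head's numerics `ν₀ := θN.ν` (the member's)
  obtain ⟨ρJ, εW, δ₀, hρJ, hεW, hδ₀, C, ρ, Kτ, ρτ, ρ5, εH, B₁, ρ6, M₂, hC, hρ, hKτ, hρτ, hρ5, hεH, hB1, hρ6, hM₂0, hmain⟩ :=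
    h12_bill_at_liveRepin₁₃Ax_of_junctionRowsRunGuarded hd3 h0 ι Z Λ k M hk0 hk1 T lo hi n hn hN hbox hZ hTG0 hN5 Kb hK1 hKn ext hext hlohi LO HI hLO hHI n' hn'
      hn'N hR' hγ hbx hbxM hM W hWbox c hkc hc X D₀ hBox hWX hfeedsX hcE0 hcE hγle hZblk hB₃ Adm h15 hAdmK hAdmTr (numerics7OfThm1CCM F.L j ε₀ B₃ B₃' a₀ a₁) hdiv₀ hfloor₀
      hMrad₀ hM₁₀ hadm₀ hscope 𝓐₁ h𝓐₁ hC₁ hCB hstep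
  refine ⟨ρJ, εW, δ₀, hρJ, hεW, hδ₀, C, ρ, Kτ, ρτ, ρ5, εH, B₁, ρ6, M₂, hC, hρ, hKτ, hρτ, hρ5, hεH, hB1, hρ6, hM₂0, ?_⟩
  intro lam hk bβ γβ tb hγβ0 hγβγ hγβe tlow hmassLive σ sq Nm p₁ Dst hDst tNN tβ0 tβ tL₀ tL₀L tB tδ tN₀ tMl tΛ L91h L95 L91 L97 L80
    hΩw hα3 hα2 haN hXΩ hfit hM4 hZ1 hdiv hcA ha₁₅ eG ρnG heG hρJ1 hρJ2 hεWr hα3h hα2h haG hρnG0 hT hnormG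
  -- ★ THE ROWS PAID AT THE PIN: `0 ≤ β′` from the sign leaf under the upper box at the point `(γβ)` of `]0, γβ]¹`; NODE O's (2.7)-smallness at `β₀ := ½`, `Lς := 2`, `r = p₀ = 1`
  -- (`smallnessFor_half_two_one`, `gamma_mul_p0Profile_le_tenth` on `γβ ≤ e⁻³`, `γβ²β′ ≤ γ²β′ ≤ ¾`, `A₀ᶜᶜ¹ ≤ A₀ᶜ ≤ 1∕16`); the upper box shrunk to `]0, γβ]`; `2 ≤ M₁ = L^j` from the head's floor row
  have hβv : (fun _ : Fin (0 + 1) => γβ) ∈ FlowStep.Box γβ 0 := FlowStep.mem_box.mpr fun _ => ⟨hγβ0, le_rfl⟩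
  have hβ'0 : 0 ≤ β' := tb.trans ((tlow 0 _ hβv).trans (hbox' 0 _ (FlowStep.box_mono hγβγ 0 hβv)))
  have hA₀ : 0 ≤ A0OfThm1CC1 F.L B₃ B₃' a₀ a₁ := A0OfThm1CC1_nonneg hB hB' ha₀.le ha₁.le
  have hA₀' : A0OfThm1CC1 F.L B₃ B₃' a₀ a₁ ≤ 1 / 16 := (A0OfThm1CC1_le hB hB' ha₀.le ha₁.le).trans (A0OfThm1C_le_sixteenth hB)
  have hγsq : γβ ^ 2 * β' ≤ 1 :=
    calc γβ ^ 2 * β' ≤ γ ^ 2 * β' := mul_le_mul_of_nonneg_right (pow_le_pow_left₀ hγβ0.le hγβγ 2) hβ'0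
      _ = β' * γ ^ 2 := mul_comm _ _
      _ ≤ 1 := hβ'.trans (by norm_num)
  have tS : SmallnessFor γβ β' (1 / 2) 2 1 := smallnessFor_half_two_one hγβ0 hγβe hβ'0 hγsq
  have t10 : γβ * p0Profile (A0OfThm1CC1 F.L B₃ B₃' a₀ a₁) 1 γβ ≤ 1 / 10 := gamma_mul_p0Profile_le_tenth hγβ0 (hγβγ.trans hγh) hA₀ hA₀'
  have hM2 : 2 ≤ (theta13OfThm1CCMWZBAx F 2 j γ a₀ ε₀ ε₂₉ B₃ B₃' a₀ a₁ Efl logz).ν.M₁ := by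
    have h18 := hfloor₀ ⟨0, 0, 0⟩
    rw [T4Family.P_d, T4Family.P_L] at h18
    have hL := F.hL.2
    omega
  -- F4's Θ-block AT THE MEMBER: the ν₀-pin `rfl`, K0b's residuals of record (node00-def-Y), `1 ≤ r`, `0 ≤ A₀`, `0 < M₂ = 1`, `0 < M = L^j`, `0 < εreg = a₀` by the member's `rfl` faces
  exact hmain (theta13OfThm1CCMWZBAx F 2 j γ a₀ ε₀ ε₂₉ B₃ B₃' a₀ a₁ Efl logz) lam hk rfl
    (hasResidualsOfRecord_theta13OfThm1CCMWZBAx F 2 j γ a₀ ε₀ ε₂₉ B₃ B₃' a₀ a₁ Efl logz) (1 / 2) bβ γβ tb tlow le_rfl hA₀ β'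
    (fun k v hv => hbox' k v (FlowStep.box_mono hγβγ k hv)) 2 tS t10 hmassLive σ sq Nm p₁ Nat.one_pos (pow_pos (lt_trans Nat.zero_lt_one F.hL.2) j)
    Dst hDst tNN tβ0 tβ tL₀ tL₀L tB tδ tN₀ tMl tΛ L91h L95 L91 L97 L80 hΩw hα3 hα2 haN hXΩ hfit hM4 hZ1 hdiv hcA hM2 ha₀ ha₁₅.le eG ρnG heG hρJ1 hρJ2
    hεWr hα3h hα2h haG ha₁₅ hρnG0 hT hnormG

end

end Summit.QuantumFields.YangMills.BalabanUVNodes.N24N12BillH12AtWitnessOfJunctionRowsRunGuardedAx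

end
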